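import Mathlib
import HarnessLib
import Summits.Ventures.LatticeQCDFlow.Scaling.CharFunTaylorBound
import Literature.Barriers.AtomisticToContinuum.DisorderedHarmonicChainLowerBoundProofs

/-!
# LatticeQCDFlow / Scaling — a RATE for the training loss: `|cgf(β) − β²σ²/2| ≤ 2|β|³K³`, hence
# `|KL_n(β) − nβ²σ²/2| ≤ 2n|β|³K³` uniformly in the volume and `|KL_n(c/√n) − c²σ²/2| ≤ 2|c|³K³/√n`

HONEST FRAMING: exact (Metropolis-corrected) sampling algorithms for lattice gauge theory;
figures of merit are autocorrelation/cost numbers at stated couplings and volumes; no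
continuum-physics claim.

Venture `LatticeQCDFlow` (cell pub-lqcd), topic `Scaling`; FANOUT row 3 (`s0-u1-a`, S0-B
implementation A, GEN-20).  NEW WORK of the cell (elementary), on row 3's `Scaling/CharFunTaylorBound`
(`abs_mgf_sub_taylor_le`: `|M(u) − 1 − u²σ²/2| ≤ |u|³K³` for `|u|K ≤ 1`) and the tree's logarithm
bound `jb_abs_log_one_add_sub_self_le` (a Literature/Barriers proof file, imported for that one
[folklore] lemma); NO definition is introduced; nothing is cited.
The diagonal laws of GEN-19/20 (`Scaling/CumulantDiagonalLimit`: `n·cgf(c/√n) → c²σ²/2`, the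
training loss `KL_n = n·cgf` of `Scaling/TiltKLDivergence`, the ESS fraction `→ e^{−c²σ²}`) were
limits without rates; this file gives the first explicit RATES of the programme, on the loss side.

## Content (all `[ours]`), bounded centred block statistic `h` (`|h| ≤ K`, `∫ h dρ = 0`, `σ² = Var h`)

* (`|log(1 + x) − x| ≤ 2x²` for `|x| ≤ 1/2` is REUSED from the tree:
  `Literature.Barriers.….HeatConduction.jb_abs_log_one_add_sub_self_le`);
* **`abs_cgf_sub_le`** — `|cgf(u) − u²σ²/2| ≤ 2|u|³K³` whenever `|u|K ≤ 1/2`;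
* **`abs_nat_mul_cgf_sub_le`** — the `n`-block reverse training loss `KL_n(β) = n·cgf(β)` is
  quadratic in the coupling with an explicit cubic error, UNIFORMLY IN THE VOLUME:
  `|n·cgf(β) − nβ²σ²/2| ≤ 2n|β|³K³` (`|β|K ≤ 1/2`);
* **`abs_nat_mul_cgf_div_sqrt_sub_le`** — on the diagonal: `|n·cgf(c/√n) − c²σ²/2| ≤ 2|c|³K³/√n`
  for `n ≥ 1` with `|c|K ≤ √n/2`;
* **`abs_log_essFrac_add_le`**, **`abs_nat_mul_log_essFrac_div_sqrt_add_le`** — the exponent of the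
  Kish ESS fraction `log(M(β)²/M(2β)) = 2cgf(β) − cgf(2β)`: `|2cgf(β) − cgf(2β) + β²σ²| ≤ 20|β|³K³`
  (`|β|K ≤ 1/4`) and `|n(2cgf − cgf(2·))(c/√n) + c²σ²| ≤ 20|c|³K³/√n`.

Reading (value-free): the training loss of the untrained sampler is `nβ²σ²/2` up to a relative error
`O(βK)`, and on the diagonal the distance to the limit `s/2` is `O((|c|K)³/√n)`; the same holds for
the logarithm of the ESS fraction with limit `−s`.
NOT CLAIMED: a rate for the acceptance (that needs a Berry–Esseen theorem, not in the tree);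
non-centred statistics (recentre); any value at the cell's `(β, L)`; nothing re-scored.
-/

noncomputable section

namespace Summit.Ventures.LatticeQCDFlow.Theory2

open MeasureTheory ProbabilityTheory Filter Finset Real Set
open scoped Topology NNReal

/-! ## §1 The logarithm

The estimate `|log(1 + x) − x| ≤ 2x²` (`|x| ≤ 1/2`) is already in the tree as
`Literature.Barriers.AtomisticToContinuum.HeatConduction.jb_abs_log_one_add_sub_self_le`
(found by the gate's statement index) and is REUSED from there. -/

/-! ## §2 The cumulant generating function of a bounded centred statistic -/

section CGF

variable {Y : Type*} {mY : MeasurableSpace Y} (ρ : Measure Y) [IsProbabilityMeasure ρ] {h : Y → ℝ}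

/-- **`|cgf(u) − u²σ²/2| ≤ 2|u|³K³` for `|u|K ≤ 1/2`** — the second-order expansion of the cumulant
generating function of a bounded centred statistic with an explicit cubic error. [ours] -/
theorem abs_cgf_sub_le (hm : Measurable h) {K : ℝ} (hK : ∀ y, |h y| ≤ K) (h0 : ∫ y, h y ∂ρ = 0)
    {u : ℝ} (hu : |u| * K ≤ 1 / 2) :
    |cgf h ρ u - u ^ 2 * Var[h; ρ] / 2| ≤ 2 * |u| ^ 3 * K ^ 3 := by
  obtain ⟨y0, -⟩ := nonempty_of_measure_ne_zero (show ρ Set.univ ≠ 0 by simp)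
  have hK0 : 0 ≤ K := (abs_nonneg _).trans (hK y0)
  have hb : ∀ᵐ y ∂ρ, h y ∈ Set.Icc (-K) K := ae_of_all _ fun y => abs_le.1 (hK y)
  have hiE : Integrable (fun y => Real.exp (u * h y)) ρ := integrable_exp_mul_of_mem_Icc hm.aemeasurable hb
  set t : ℝ := |u| * K with ht
  have ht0 : 0 ≤ t := mul_nonneg (abs_nonneg _) hK0
  have ht1 : t ≤ 1 := hu.trans (by norm_num)
  -- the Taylor bound for the moment generating function
  have hT := abs_mgf_sub_taylor_le ρ hm hK h0 (u := u) ht1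
  set x : ℝ := mgf h ρ u - 1 with hx
  set a : ℝ := u ^ 2 * Var[h; ρ] / 2 with ha
  have hxa : |x - a| ≤ t ^ 3 := by
    rw [hx, ha, ht, mul_pow]
    convert hT using 2; ring
  -- `0 ≤ a ≤ t²/2`
  have hvar : Var[h; ρ] ≤ K ^ 2 := by
    have hv := variance_le_sq_of_bounded hb hm.aemeasurable
    calc Var[h; ρ] ≤ ((K - -K) / 2) ^ 2 := hv
      _ = K ^ 2 := by ring
  have ha0 : 0 ≤ a := by rw [ha]; exact div_nonneg (mul_nonneg (sq_nonneg _) (variance_nonneg _ _)) two_pos.le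
  have ha1 : a ≤ t ^ 2 / 2 := by
    rw [ha, ht, mul_pow, sq_abs]
    exact div_le_div_of_nonneg_right (mul_le_mul_of_nonneg_left hvar (sq_nonneg _)) two_pos.le
  -- `|x| ≤ a + t³ ≤ 1/4`
  have hx1 : |x| ≤ t ^ 2 / 2 + t ^ 3 := by
    calc |x| = |(x - a) + a| := by ring_nf
      _ ≤ |x - a| + |a| := abs_add_le _ _
      _ ≤ t ^ 3 + a := by rw [abs_of_nonneg ha0]; exact add_le_add hxa le_rfl
      _ ≤ t ^ 3 + t ^ 2 / 2 := by linarith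
      _ = t ^ 2 / 2 + t ^ 3 := by ring
  have ht2 : t ≤ 1 / 2 := hu
  have hx2 : |x| ≤ 1 / 2 := by
    have : t ^ 2 / 2 + t ^ 3 ≤ 1 / 2 := by nlinarith [sq_nonneg t, mul_nonneg ht0 (sq_nonneg t)]
    exact hx1.trans this
  -- the logarithm
  have hlog := Literature.Barriers.AtomisticToContinuum.HeatConduction.jb_abs_log_one_add_sub_self_le hx2
  have hcgf : cgf h ρ u = Real.log (1 + x) := by
    rw [cgf, hx, add_sub_cancel]
  have hsq : 2 * x ^ 2 ≤ t ^ 3 := by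
    have h1 : x ^ 2 ≤ (t ^ 2 / 2 + t ^ 3) ^ 2 := by
      rw [← sq_abs x]; exact pow_le_pow_left₀ (abs_nonneg _) hx1 2
    have h2 : (t ^ 2 / 2 + t ^ 3) ^ 2 = t ^ 3 * (t * (1 / 2 + t) ^ 2) := by ring
    have h3 : (1 / 2 + t) ^ 2 ≤ 1 := by
      have : 1 / 2 + t ≤ 1 := by linarith
      have h' : 0 ≤ 1 / 2 + t := by linarith
      calc (1 / 2 + t) ^ 2 ≤ 1 ^ 2 := pow_le_pow_left₀ h' this 2
        _ = 1 := one_pow 2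
    have h4 : t * (1 / 2 + t) ^ 2 ≤ 1 / 2 := by
      calc t * (1 / 2 + t) ^ 2 ≤ (1 / 2) * 1 :=
            mul_le_mul ht2 h3 (sq_nonneg _) (by norm_num)
        _ = 1 / 2 := by norm_num
    have h5 : (t ^ 2 / 2 + t ^ 3) ^ 2 ≤ t ^ 3 * (1 / 2) := by
      rw [h2]; exact mul_le_mul_of_nonneg_left h4 (pow_nonneg ht0 3)
    linarith
  calc |cgf h ρ u - a| = |(Real.log (1 + x) - x) + (x - a)| := by rw [hcgf]; ring_nf
    _ ≤ |Real.log (1 + x) - x| + |x - a| := abs_add_le _ _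
    _ ≤ 2 * x ^ 2 + t ^ 3 := add_le_add hlog hxa
    _ ≤ t ^ 3 + t ^ 3 := by linarith
    _ = 2 * |u| ^ 3 * K ^ 3 := by rw [ht]; ring

/-- **THE TRAINING LOSS IS QUADRATIC IN THE COUPLING, UNIFORMLY IN THE VOLUME**: the `n`-block
reverse loss `KL_n(β) = n·cgf(β)` (`Scaling/TiltKLDivergence`, centred statistic) satisfies
`|n·cgf(β) − n·β²σ²/2| ≤ 2n|β|³K³` for `|β|K ≤ 1/2`. [ours] -/
theorem abs_nat_mul_cgf_sub_le (hm : Measurable h) {K : ℝ} (hK : ∀ y, |h y| ≤ K)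
    (h0 : ∫ y, h y ∂ρ = 0) {β : ℝ} (hβ : |β| * K ≤ 1 / 2) (n : ℕ) :
    |(n : ℝ) * cgf h ρ β - n * (β ^ 2 * Var[h; ρ] / 2)| ≤ 2 * n * |β| ^ 3 * K ^ 3 := by
  rw [← mul_sub, abs_mul, Nat.abs_cast]
  have hmain := abs_cgf_sub_le ρ hm hK h0 hβ
  calc (n : ℝ) * |cgf h ρ β - β ^ 2 * Var[h; ρ] / 2| ≤ n * (2 * |β| ^ 3 * K ^ 3) :=
        mul_le_mul_of_nonneg_left hmain (Nat.cast_nonneg n)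
    _ = 2 * n * |β| ^ 3 * K ^ 3 := by ring

/-- **THE RATE ON THE DIAGONAL**: for `n ≥ 1` and `|c|K ≤ √n/2`,
`|n·cgf(c/√n) − c²σ²/2| ≤ 2|c|³K³/√n` — the distance of the total training loss to its limit `s/2`
(`Scaling/CumulantDiagonalLimit`, `Scaling/TiltKLDiagonalLimit`). [ours] -/
theorem abs_nat_mul_cgf_div_sqrt_sub_le (hm : Measurable h) {K : ℝ} (hK : ∀ y, |h y| ≤ K)
    (h0 : ∫ y, h y ∂ρ = 0) {c : ℝ} {n : ℕ} (hn : 0 < n) (hc : |c| * K ≤ Real.sqrt n / 2) :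
    |(n : ℝ) * cgf h ρ (c / Real.sqrt n) - c ^ 2 * Var[h; ρ] / 2|
      ≤ 2 * |c| ^ 3 * K ^ 3 / Real.sqrt n := by
  have hs : 0 < Real.sqrt n := Real.sqrt_pos.2 (Nat.cast_pos.2 hn)
  have hβ : |c / Real.sqrt n| * K ≤ 1 / 2 := by
    rw [abs_div, abs_of_pos hs, div_mul_eq_mul_div, div_le_iff₀ hs]
    linarith
  have hmain := abs_nat_mul_cgf_sub_le ρ hm hK h0 hβ n
  have e1 : (n : ℝ) * ((c / Real.sqrt n) ^ 2 * Var[h; ρ] / 2) = c ^ 2 * Var[h; ρ] / 2 := by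
    rw [div_pow, Real.sq_sqrt (Nat.cast_nonneg n)]
    field_simp
  have e2 : 2 * (n : ℝ) * |c / Real.sqrt n| ^ 3 * K ^ 3 = 2 * |c| ^ 3 * K ^ 3 / Real.sqrt n := by
    rw [abs_div, abs_of_pos hs, div_pow]
    have hn3 : Real.sqrt n ^ 3 = n * Real.sqrt n := by
      rw [pow_succ, Real.sq_sqrt (Nat.cast_nonneg n)]
    rw [hn3]
    field_simp
  rw [e1, e2] at hmain
  exact hmain

/-- **The exponent of the ESS fraction**: `log(M(β)²/M(2β)) = 2cgf(β) − cgf(2β)` satisfies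
`|2cgf(β) − cgf(2β) + β²σ²| ≤ 20|β|³K³` for `|β|K ≤ 1/4`. [ours] -/
theorem abs_log_essFrac_add_le (hm : Measurable h) {K : ℝ} (hK : ∀ y, |h y| ≤ K)
    (h0 : ∫ y, h y ∂ρ = 0) {β : ℝ} (hβ : |β| * K ≤ 1 / 4) :
    |2 * cgf h ρ β - cgf h ρ (2 * β) + β ^ 2 * Var[h; ρ]| ≤ 20 * |β| ^ 3 * K ^ 3 := by
  have h1 := abs_cgf_sub_le ρ hm hK h0 (u := β) (by linarith)
  have h2 := abs_cgf_sub_le ρ hm hK h0 (u := 2 * β)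
    (by rw [abs_mul, abs_two]; linarith)
  rw [abs_mul, abs_two] at h2
  have e : 2 * cgf h ρ β - cgf h ρ (2 * β) + β ^ 2 * Var[h; ρ]
      = 2 * (cgf h ρ β - β ^ 2 * Var[h; ρ] / 2) - (cgf h ρ (2 * β) - (2 * β) ^ 2 * Var[h; ρ] / 2) := by
    ring
  rw [e]
  calc |2 * (cgf h ρ β - β ^ 2 * Var[h; ρ] / 2) - (cgf h ρ (2 * β) - (2 * β) ^ 2 * Var[h; ρ] / 2)|
      ≤ |2 * (cgf h ρ β - β ^ 2 * Var[h; ρ] / 2)| + |cgf h ρ (2 * β) - (2 * β) ^ 2 * Var[h; ρ] / 2| :=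
        abs_sub _ _
    _ ≤ 2 * (2 * |β| ^ 3 * K ^ 3) + 2 * (2 * |β|) ^ 3 * K ^ 3 := by
        rw [abs_mul, abs_two]
        exact add_le_add (mul_le_mul_of_nonneg_left h1 two_pos.le) h2
    _ = 20 * |β| ^ 3 * K ^ 3 := by ring

/-- **THE ESS EXPONENT ON THE DIAGONAL**: for `n ≥ 1`, `|c|K ≤ √n/4`:
`|n·(2cgf(c/√n) − cgf(2c/√n)) + c²σ²| ≤ 20|c|³K³/√n` — the distance of `log ESS_n` to its limit
`−s` (`Scaling/CumulantDiagonalLimit.tendsto_essFrac_diag`). [ours] -/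
theorem abs_nat_mul_log_essFrac_div_sqrt_add_le (hm : Measurable h) {K : ℝ} (hK : ∀ y, |h y| ≤ K)
    (h0 : ∫ y, h y ∂ρ = 0) {c : ℝ} {n : ℕ} (hn : 0 < n) (hc : |c| * K ≤ Real.sqrt n / 4) :
    |(n : ℝ) * (2 * cgf h ρ (c / Real.sqrt n) - cgf h ρ (2 * (c / Real.sqrt n))) + c ^ 2 * Var[h; ρ]|
      ≤ 20 * |c| ^ 3 * K ^ 3 / Real.sqrt n := by
  have hs : 0 < Real.sqrt n := Real.sqrt_pos.2 (Nat.cast_pos.2 hn)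
  have hβ : |c / Real.sqrt n| * K ≤ 1 / 4 := by
    rw [abs_div, abs_of_pos hs, div_mul_eq_mul_div, div_le_iff₀ hs]
    linarith
  have hmain := abs_log_essFrac_add_le ρ hm hK h0 hβ
  have e1 : (n : ℝ) * (2 * cgf h ρ (c / Real.sqrt n) - cgf h ρ (2 * (c / Real.sqrt n)))
        + c ^ 2 * Var[h; ρ]
      = n * (2 * cgf h ρ (c / Real.sqrt n) - cgf h ρ (2 * (c / Real.sqrt n))
        + (c / Real.sqrt n) ^ 2 * Var[h; ρ]) := by
    rw [div_pow, Real.sq_sqrt (Nat.cast_nonneg n)]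
    field_simp
  have e2 : (n : ℝ) * (20 * |c / Real.sqrt n| ^ 3 * K ^ 3) = 20 * |c| ^ 3 * K ^ 3 / Real.sqrt n := by
    rw [abs_div, abs_of_pos hs, div_pow]
    have hn3 : Real.sqrt n ^ 3 = n * Real.sqrt n := by
      rw [pow_succ, Real.sq_sqrt (Nat.cast_nonneg n)]
    rw [hn3]
    field_simp
  rw [e1, abs_mul, Nat.abs_cast, ← e2]
  exact mul_le_mul_of_nonneg_left hmain (Nat.cast_nonneg n)

end CGF

end Summit.Ventures.LatticeQCDFlow.Theory2

end
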